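import Mathlib.Analysis.InnerProductSpace.PiL2
import Mathlib.Algebra.Order.BigOperators.Ring.Finset
import HarnessLib

/-!
# A lattice (Fourier-side) commutator estimate: `[χ(D), b·∇]` is bounded by the LIPSCHITZ constant of the
# symbol times the gradient-weighted Wiener norm of the drift

Analysis/Fourier support file (everything proved; no definitions beyond one abbreviation, no named facts).
On the Fourier side of the torus `𝕋^d` (lattice `ℤ^d`), transport by a trigonometric-polynomial drift `b`
acts on coefficient families by the discrete convolution `(b·∇v)^(k) = Σ_j Σ_a b̂_j,a (2πi (k−j)_a) v̂(k−j)`,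
and a Fourier multiplier `χ(D)` acts diagonally, `(χ(D)v)^(k) = χ(k) v̂(k)`.  Their commutator is the
convolution with the DIFFERENCE of symbols,
`([χ(D), b·∇] v)^(k) = Σ_j (χ(k) − χ(k−j)) Σ_a b̂_j,a (2πi (k−j)_a) v̂(k−j)`,
so a symbol with `|χ(k) − χ(k′)| ≤ λ‖k − k′‖` (e.g. `χ(·/L)`, `λ = ‖χ′‖_∞/L`) gives, by the weighted
Cauchy–Schwarz / discrete Young inequality,
`Σ_k ‖([χ(D), b·∇]v)^(k)‖² ≤ (2π λ Σ_j ‖j‖·‖b̂_j‖₁)² · Σ_k ‖k‖²‖v̂(k)‖²`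
— the commutator costs the GRADIENT of the drift (`Σ_j ‖j‖‖b̂_j‖` is a Wiener-algebra norm of `∇b`),
not its size: sweeping by large smooth velocities does not move energy across dyadic shells, only strain
does.  This is the Fourier-lattice form of the classical commutator lemma for transport operators
(DiPerna–Lions 1989, §II.1, Lemma II.1: `[ρ_ε∗, b·∇] → 0` controlled by `∇b`), written with finite sums so
that it applies verbatim to Galerkin truncations; the discrete Young inequality is Grafakos 2014, Thm 1.2.10
specialised to `ℓ¹ ∗ ℓ² → ℓ²` on `ℤ^d` (finite supports).

* `sum_sq_sum_shift_le` — discrete Young `ℓ¹ ∗ ℓ² ⊂ ℓ²` for finitely supported nonnegative families on an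
  additive group: `Σ_{k∈K} (Σ_{j∈J} w_j G(k−j))² ≤ (Σ_j w_j)² Σ_{k′∈S} G(k′)²` (`G ≥ 0` vanishing off `S`).
* `latticeTransport`, `latticeCommutator`, `latticeCommutator_eq` — the Fourier-side transport action and the
  commutator, with the identity `[χ(D), b·∇] = χ(D)(b·∇) − (b·∇)χ(D)` coefficientwise;
* `norm_latticeCommutator_le` — the pointwise bound of the commutator coefficient;
* `sum_norm_sq_latticeCommutator_le` — the `ℓ²` bound above.

Consumer: cell `ad-ideate`, K1L_D `stmt-AnomalousDissipation-27980`, S23‴ sub-stub W3-E (γ) (`stub_effectiveFrameEnergyL`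
v23: band kill with hop tail for the coarse propagator — the dyadic ladder's one analytic input is
`‖[χ(D/L), b_{≤m}·∇]‖ ≲ ‖∇b_{≤m}‖`).

## Mathlib / tree search
Mathlib: `Finset.sum_sq_le_sum_mul_sum_of_sq_le_mul` (weighted Cauchy–Schwarz), `Finset.sum_image`,
`Finset.sum_subset`, `Finset.sum_le_sum_of_subset_of_nonneg`; no discrete Young / lattice commutator lemma in
the tree (`rg "Young" Literature/Analysis/Fourier`, `rg commutator Literature/Analysis/Fourier`: unrelated hits).

## References
* R. J. DiPerna, P.-L. Lions, Invent. Math. 98 (1989), §II.1, Lemma II.1 (commutator of regularisation with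
  transport, controlled by `∇b`). [`DiPernaLions1989`]
* L. Grafakos, *Classical Fourier Analysis*, 3rd ed. (2014), Thm 1.2.10 (Young's inequality). [`Grafakos2014`]
-/

noncomputable section

open Finset
open scoped BigOperators

namespace Literature.Analysis.Fourier

namespace LatticeCommutator

variable {ι : Type*} [AddCommGroup ι] [DecidableEq ι]

/-! ## §1 Discrete Young `ℓ¹ ∗ ℓ² ⊂ ℓ²` (finite supports) -/

/-- Shifted sums of a family vanishing off `S` are dominated by the full sum over `S`:
`Σ_{k∈K} G(k − j)² ≤ Σ_{k′∈S} G(k′)²`. [cite: Grafakos2014, Thm 1.2.10] -/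
theorem sum_sq_shift_le (K S : Finset ι) (G : ι → ℝ) (hG : ∀ k, k ∉ S → G k = 0) (j : ι) :
    ∑ k ∈ K, G (k - j) ^ 2 ≤ ∑ k' ∈ S, G k' ^ 2 := by
  have hinj : Set.InjOn (fun k : ι => k - j) (K : Set ι) := fun a _ b _ h => by simpa using h
  rw [← Finset.sum_image (f := fun k' => G k' ^ 2) hinj]
  -- restrict to `S`: off `S` the terms vanish
  have h1 : ∑ k' ∈ K.image (fun k => k - j), G k' ^ 2 = ∑ k' ∈ (K.image (fun k => k - j)).filter (· ∈ S), G k' ^ 2 := by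
    rw [Finset.sum_filter]
    refine Finset.sum_congr rfl fun k' _ => ?_
    by_cases h : k' ∈ S
    · simp [h]
    · simp [h, hG k' h]
  rw [h1]
  exact Finset.sum_le_sum_of_subset_of_nonneg (fun k' hk' => (Finset.mem_filter.1 hk').2) fun _ _ _ => sq_nonneg _

/-- **Discrete Young inequality, `ℓ¹ ∗ ℓ² ⊂ ℓ²` form with finite supports**: for nonnegative weights `w` on
`J` and a real family `G` vanishing off `S`,
`Σ_{k∈K} (Σ_{j∈J} w_j G(k−j))² ≤ (Σ_{j∈J} w_j)² · Σ_{k′∈S} G(k′)²` for every finite `K`. [cite: Grafakos2014, Thm 1.2.10] -/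
theorem sum_sq_sum_shift_le (K J S : Finset ι) (w : ι → ℝ) (hw : ∀ j ∈ J, 0 ≤ w j) (G : ι → ℝ)
    (hG : ∀ k, k ∉ S → G k = 0) :
    ∑ k ∈ K, (∑ j ∈ J, w j * G (k - j)) ^ 2 ≤ (∑ j ∈ J, w j) ^ 2 * ∑ k' ∈ S, G k' ^ 2 := by
  -- weighted Cauchy–Schwarz at each `k`
  have hk : ∀ k ∈ K, (∑ j ∈ J, w j * G (k - j)) ^ 2 ≤ (∑ j ∈ J, w j) * ∑ j ∈ J, w j * G (k - j) ^ 2 := by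
    intro k _
    refine Finset.sum_sq_le_sum_mul_sum_of_sq_le_mul J hw (fun j hj => mul_nonneg (hw j hj) (sq_nonneg _))
      fun j hj => ?_
    have : (w j * G (k - j)) ^ 2 = w j * (w j * G (k - j) ^ 2) := by ring
    exact this.le
  refine (Finset.sum_le_sum hk).trans ?_
  rw [← Finset.mul_sum, Finset.sum_comm]
  -- `Σ_j w_j Σ_k G(k−j)² ≤ (Σ_j w_j) Σ_S G²`
  have h2 : ∑ j ∈ J, ∑ k ∈ K, w j * G (k - j) ^ 2 ≤ ∑ j ∈ J, w j * ∑ k' ∈ S, G k' ^ 2 := by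
    refine Finset.sum_le_sum fun j hj => ?_
    rw [← Finset.mul_sum]
    exact mul_le_mul_of_nonneg_left (sum_sq_shift_le K S G hG j) (hw j hj)
  refine (mul_le_mul_of_nonneg_left h2 (Finset.sum_nonneg hw)).trans ?_
  rw [← Finset.sum_mul, sq, mul_assoc]

/-! ## §2 The lattice commutator `[χ(D), b·∇]` -/

variable {d : Type*} [Fintype d] {E : Type*} [NormedAddCommGroup E] [NormedSpace ℂ E]

/-- The Fourier-side action of `[χ(D), b·∇]` on a coefficient family `v̂` at the wave vector `k`:
`Σ_{j∈J} (χ(k) − χ(k−j)) · (Σ_a b̂_j,a · 2πi (k−j)_a) • v̂(k−j)` (`J` = the frequency support of the drift,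
`b̂_j ∈ ℂ^d` its vector coefficients, integer wave vectors read as reals through `κ`). [cite: DiPernaLions1989, §II.1 Lemma II.1] -/
def latticeCommutator (κ : (d → ℤ) → d → ℝ) (χ : (d → ℤ) → ℝ) (J : Finset (d → ℤ)) (bhat : (d → ℤ) → d → ℂ)
    (vhat : (d → ℤ) → E) (k : d → ℤ) : E :=
  ∑ j ∈ J, ((χ k - χ (k - j) : ℝ) : ℂ) • ((∑ a, bhat j a * (2 * Real.pi * Complex.I * (κ (k - j) a : ℂ))) • vhat (k - j))

/-- The Fourier-side action of the transport operator `v ↦ (b·∇)v` on a coefficient family: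
`((b·∇)v)^(k) = Σ_{j∈J} (Σ_a b̂_j,a · 2πi (k−j)_a) • v̂(k−j)`. [cite: DiPernaLions1989, §II.1 Lemma II.1] -/
def latticeTransport (κ : (d → ℤ) → d → ℝ) (J : Finset (d → ℤ)) (bhat : (d → ℤ) → d → ℂ)
    (vhat : (d → ℤ) → E) (k : d → ℤ) : E :=
  ∑ j ∈ J, (∑ a, bhat j a * (2 * Real.pi * Complex.I * (κ (k - j) a : ℂ))) • vhat (k - j)

/-- **It is a commutator**: `([χ(D), b·∇]v)^ = χ · ((b·∇)v)^ − ((b·∇)(χ(D)v))^` coefficientwise.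
[cite: DiPernaLions1989, §II.1 Lemma II.1] -/
theorem latticeCommutator_eq (κ : (d → ℤ) → d → ℝ) (χ : (d → ℤ) → ℝ) (J : Finset (d → ℤ)) (bhat : (d → ℤ) → d → ℂ)
    (vhat : (d → ℤ) → E) (k : d → ℤ) :
    latticeCommutator κ χ J bhat vhat k =
      ((χ k : ℝ) : ℂ) • latticeTransport κ J bhat vhat k -
        latticeTransport κ J bhat (fun k' => ((χ k' : ℝ) : ℂ) • vhat k') k := by
  unfold latticeCommutator latticeTransport
  rw [Finset.smul_sum, ← Finset.sum_sub_distrib]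
  refine Finset.sum_congr rfl fun j _ => ?_
  simp only [smul_smul, Complex.ofReal_sub]
  rw [sub_mul, sub_smul, mul_comm (((χ (k - j) : ℝ) : ℂ))]

/-- **Pointwise bound of the commutator coefficient**: with `|χ(k) − χ(k′)| ≤ λ·N(k − k′)` and
`|Σ_a b̂_j,a (2πi κ_a)| ≤ 2π ‖b̂_j‖₁ ‖κ‖`,
`‖([χ(D), b·∇]v)^(k)‖ ≤ Σ_j (λ N(j) · 2π ‖b̂_j‖₁) · (‖κ(k−j)‖·‖v̂(k−j)‖)`. [cite: DiPernaLions1989, §II.1 Lemma II.1] -/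
theorem norm_latticeCommutator_le (κ : (d → ℤ) → d → ℝ) (N : (d → ℤ) → ℝ) {χ : (d → ℤ) → ℝ} {lam : ℝ}
    (hχ : ∀ k k' : d → ℤ, |χ k - χ k'| ≤ lam * N (k - k')) (J : Finset (d → ℤ)) (bhat : (d → ℤ) → d → ℂ)
    (vhat : (d → ℤ) → E) (k : d → ℤ) :
    ‖latticeCommutator κ χ J bhat vhat k‖ ≤
      ∑ j ∈ J, (lam * N j * (2 * Real.pi * ∑ a, ‖bhat j a‖)) * ((∑ a, |κ (k - j) a|) * ‖vhat (k - j)‖) := by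
  unfold latticeCommutator
  refine (norm_sum_le _ _).trans (Finset.sum_le_sum fun j _ => ?_)
  rw [norm_smul, norm_smul, Complex.norm_real, Real.norm_eq_abs]
  have h1 : |χ k - χ (k - j)| ≤ lam * N j := by simpa using hχ k (k - j)
  have h2 : ‖∑ a, bhat j a * (2 * Real.pi * Complex.I * (κ (k - j) a : ℂ))‖ ≤
      (2 * Real.pi * ∑ a, ‖bhat j a‖) * ∑ a, |κ (k - j) a| := by
    refine (norm_sum_le _ _).trans ?_
    have h3 : ∀ a, ‖bhat j a * (2 * Real.pi * Complex.I * (κ (k - j) a : ℂ))‖ = 2 * Real.pi * ‖bhat j a‖ * |κ (k - j) a| := by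
      intro a
      rw [norm_mul, norm_mul, norm_mul, Complex.norm_I, mul_one, Complex.norm_real, Real.norm_eq_abs]
      rw [show ‖(2 * Real.pi : ℂ)‖ = 2 * Real.pi by
        rw [show (2 * Real.pi : ℂ) = ((2 * Real.pi : ℝ) : ℂ) by push_cast; ring, Complex.norm_real, Real.norm_eq_abs,
          abs_of_pos Real.two_pi_pos]]
      ring
    simp_rw [h3]
    -- `Σ_a 2π‖b̂_a‖|κ_a| ≤ Σ_a 2π (Σ_a' ‖b̂_a'‖) |κ_a|`
    rw [Finset.mul_sum]
    refine Finset.sum_le_sum fun a _ => ?_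
    have hba : ‖bhat j a‖ ≤ ∑ a', ‖bhat j a'‖ :=
      Finset.single_le_sum (f := fun a' => ‖bhat j a'‖) (fun a' _ => norm_nonneg _) (Finset.mem_univ a)
    have hκ : 0 ≤ |κ (k - j) a| := abs_nonneg _
    have h2pi : 0 ≤ 2 * Real.pi := Real.two_pi_pos.le
    calc 2 * Real.pi * ‖bhat j a‖ * |κ (k - j) a| = (2 * Real.pi) * (‖bhat j a‖ * |κ (k - j) a|) := by ring
      _ ≤ (2 * Real.pi) * ((∑ a', ‖bhat j a'‖) * |κ (k - j) a|) :=
          mul_le_mul_of_nonneg_left (mul_le_mul_of_nonneg_right hba hκ) h2pi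
      _ = (2 * Real.pi * ∑ a', ‖bhat j a'‖) * |κ (k - j) a| := by ring
  have hnn : 0 ≤ ‖vhat (k - j)‖ := norm_nonneg _
  calc |χ k - χ (k - j)| * (‖∑ a, bhat j a * (2 * Real.pi * Complex.I * (κ (k - j) a : ℂ))‖ * ‖vhat (k - j)‖)
      ≤ (lam * N j) * (((2 * Real.pi * ∑ a, ‖bhat j a‖) * ∑ a, |κ (k - j) a|) * ‖vhat (k - j)‖) := by
        refine mul_le_mul h1 (mul_le_mul_of_nonneg_right h2 hnn) (by positivity) ?_
        exact (abs_nonneg _).trans h1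
    _ = (lam * N j * (2 * Real.pi * ∑ a, ‖bhat j a‖)) * ((∑ a, |κ (k - j) a|) * ‖vhat (k - j)‖) := by ring

/-- **The `ℓ²` bound of the lattice commutator** (finite supports): if `|χ(k) − χ(k′)| ≤ λ N(k − k′)` with
`N ≥ 0` on `J`, `λ ≥ 0`, and `v̂` vanishes off `S`, then for every finite `K`
`Σ_{k∈K} ‖([χ(D), b·∇]v)^(k)‖² ≤ (Σ_{j∈J} λ N(j) 2π ‖b̂_j‖₁)² · Σ_{k′∈S} (‖κ(k′)‖₁ ‖v̂(k′)‖)²`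
— Lipschitz constant of the symbol × gradient-weighted Wiener norm of the drift × gradient-weighted energy.
[cite: DiPernaLions1989, §II.1 Lemma II.1] [cite: Grafakos2014, Thm 1.2.10] -/
theorem sum_norm_sq_latticeCommutator_le (κ : (d → ℤ) → d → ℝ) (N : (d → ℤ) → ℝ) {χ : (d → ℤ) → ℝ}
    {lam : ℝ} (hlam : 0 ≤ lam) (hN : ∀ j, 0 ≤ N j)
    (hχ : ∀ k k' : d → ℤ, |χ k - χ k'| ≤ lam * N (k - k')) (J S K : Finset (d → ℤ)) (bhat : (d → ℤ) → d → ℂ)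
    (vhat : (d → ℤ) → E) (hv : ∀ k, k ∉ S → vhat k = 0) :
    ∑ k ∈ K, ‖latticeCommutator κ χ J bhat vhat k‖ ^ 2 ≤
      (∑ j ∈ J, lam * N j * (2 * Real.pi * ∑ a, ‖bhat j a‖)) ^ 2 *
        ∑ k' ∈ S, ((∑ a, |κ k' a|) * ‖vhat k'‖) ^ 2 := by
  set w : (d → ℤ) → ℝ := fun j => lam * N j * (2 * Real.pi * ∑ a, ‖bhat j a‖) with hw
  set G : (d → ℤ) → ℝ := fun k' => (∑ a, |κ k' a|) * ‖vhat k'‖ with hG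
  have hw0 : ∀ j ∈ J, 0 ≤ w j := fun j _ =>
    mul_nonneg (mul_nonneg hlam (hN j)) (mul_nonneg Real.two_pi_pos.le (Finset.sum_nonneg fun _ _ => norm_nonneg _))
  have hGS : ∀ k', k' ∉ S → G k' = 0 := fun k' hk' => by simp only [hG, hv k' hk', norm_zero, mul_zero]
  have hpt : ∀ k ∈ K, ‖latticeCommutator κ χ J bhat vhat k‖ ^ 2 ≤ (∑ j ∈ J, w j * G (k - j)) ^ 2 := by
    intro k _
    have h := norm_latticeCommutator_le κ N hχ J bhat vhat k
    have h0 : 0 ≤ ‖latticeCommutator κ χ J bhat vhat k‖ := norm_nonneg _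
    exact pow_le_pow_left₀ h0 h 2
  exact (Finset.sum_le_sum hpt).trans (sum_sq_sum_shift_le K J S w hw0 G hGS)

end LatticeCommutator

end Literature.Analysis.Fourier

end
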